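import Summits.QuantumFields.YangMills.Theorems.BalabanUVNodesN22KernelSlotThresholdLocatedSize
import Summits.QuantumFields.YangMills.Theorems.BalabanUVNodesN22KernelCarrierCensusOfRecord13

/-!
# BalabanUVNodes ∕ node N22 = NE9 — module J95: WHAT THE ROAD OF RECORD r2 («M SUFFICIENTLY LARGE», director-ym №282 (C)) DOES AT THE N22 END —
# the located size of №276 DISSOLVES (M-free `8κ₀ ≤ κ`) and the kernel-pin census constant becomes `16·(1 + 2M∕κ₀)⁴`

Cell `pub-ymgap`, HUMAN RULING D-0062 (Track A), R134 seat `pub-ymgap-dag-n22-c` (strategy s1), generation 29, module J95.  THEOREMS ONLY (no `def`, no `sorry`,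
standard axioms); `--kind proof --supports stmt-QuantumFields-27366 --as helper` (K3⁸), COUNT-NEUTRAL.  Imports this lane's J92 (`…N22KernelSlotThresholdLocatedSize`:
the r3 located size, the numerals `325 < κ₀(64,8) < 327`, `hrate`'s right side at `consts`) and J94 (`…N22KernelCarrierCensusOfRecord13`: the floor-free (0.26) census on
NODE 00's kernel carrier).  Nothing re-declared.

THE WORD SIZED.  Director-ym №282 (C) (2026-08-29): for the single U3 letter `ℓ.κ` — the decay slot `R.u3.κ` of node U3's bundle of record, a rate per UNIT ℓ¹-length of
the limiting kernel's lattice argument at the N22 pin (J94 §3, `rfl`) — the road of record at the next content-driven re-pin of K3⁸∕N19′ is **r2**: node N19′'s `hlink`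
census reads tree length in M-cubes, so its threshold on the slot becomes `kappa₀ 64 8 ≤ M·ℓ.κ` (the «block floor» below; M = the block count of [I] p. 257, chosen «much
bigger than the previously fixed scales») in place of today's r3 floor `kappa₀ 64 8 ≤ ℓ.κ` (sized by J92).  This lane's ROAD-2 socket of record J89 (p702380) displays, on
the same letter and its neighbours, `hℓκ : ℓ.κ ≤ delta1 δ₀ κ ((M : ℝ) * 4)` ((5.10)'s kernel rate `½ min{δ₀, κ(4M)⁻¹}`), `hκ₅ : delta1 δ₀ κ ((M : ℝ) * 4) ≤ κ₅`, `hκE : κ ≤ κE`,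
`hκr : κE ≤ r₁`, its own activity threshold `hκ₀ : kappa₀ (4 * 2 ^ 4) (2 * 4) ≤ κ / 2`, the row `hrate : r₁ + 2·(64·log 162) + 2 ≤ (1 − 8c.δ)·(c.L/2)·c.κ` and the fading-memory
factor `Real.exp (delta1 δ₀ κ ((M:ℝ)*4) * ((M:ℝ)*4) * 3)`.  THIS FILE records, on those row types VERBATIM, what the r2 block floor forces — and what it buys at the kernel pin:
* §0 the r3 floor implies the r2 block floor for every `M ≥ 1` (`blockFloor_of_floor`) — so J93's on-floor joint witness (p710514) meets r2's conjunct a fortiori; and AT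
  J89's cap value `ℓ.κ = delta1 δ₀ κ (4M)` with `δ₀` not binding the block floor READS `8κ₀ ≤ κ` — a threshold on the ACTIVITY letter alone (`blockFloor_at_delta1_iff`).
* §1 ★ `locatedSize_of_kernelSlotBlockFloor`: block floor + `hℓκ hκ₅ hκE hκr` ⊢ `2κ₀ ≤ M·δ₀`, **`8κ₀ ≤ κ ≤ κE ≤ r₁` with NO M** (r3: `8Mκ₀ ≤ κ`, J92 §1), `κ₀ ≤ M·κ₅`, and the
  `hC₉` factor is `≥ exp (12κ₀)` (r3: `≥ exp (12Mκ₀)`); numeric faces (`locatedSize_blockFloor_numerals`).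
* §2 at the certified constants record `consts`: a block-floor-sized `r₁ ≥ 8κ₀` meets `hrate` (`10κ₀ + 2 ≤ 32κ₀ + 2048`) and lies in J90's certificate range
  `[2κ₀ + 1, consts.κ − 1]` — both M-FREE; ★ `blockFloor_jointRateRows_witness_every_blockCount`: for EVERY block count `M ≥ 1` the five rate rows + block floor + `hκ₀` +
  `hrate`@`consts` are jointly met at `ℓ.κ := κ₀/M`, `δ₀ := 2κ₀/M`, `κ = κE = r₁ := 8κ₀`, `κ₅ := κ₀/M` (the kernel letter → 0 as M → ∞, as (5.10)'s δ₁).  So J92 §2's caps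
  «M ≤ 4 at `consts`» ∕ «M ≤ 2 on J90's range» are artefacts of the r3 floor and VANISH under r2.
* §3 AT THE KERNEL PIN (J94): the census there is floor-free with constant `16·K₁ 4 ℓ.κ ≤ 16(1 + 2/ℓ.κ)⁴`; ON the block floor `2/ℓ.κ ≤ 2M/κ₀`, so ★★
  `multiplicity_kernelCarriers_on_blockFloor` ∕ `multiplicity_u3OfRecord₁₃_objectsOfRecord₁₃_on_blockFloor`: `Multiplicity … (16·(1 + 2M/κ₀ 64 8)⁴) vol Λ K` UNIFORMLY in
  `ℓ.κ` — polynomial of degree d = 4 in the block count, the `M^d` of [I] p. 257 («cubes from π_j become unit cubes»); §4: `< 16(1 + M/162)⁴`; on the r3 floor `< 17`.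

HONEST FRAMING (binding).  Bookkeeping on displayed hypothesis letters plus an elementary lattice-sum bound; the re-typed `hlink` conjunct is node N19′'s to print at the
re-pin (this file sizes the director's displayed threshold `kappa₀ 64 8 ≤ M·ℓ.κ` verbatim, spelled `kappa₀ (4 * 2 ^ 4) (2 * 4) ≤ (M : ℝ) * ℓ.κ` as the rows spell κ₀); the joint
letters stay SATISFIABLE (§2); nothing of Bałaban's is asserted or denied; no statement of record is edited (DO-NOT-REKEY №265–№269); N22 NOT discharged; K3⁸ OPEN; counts
UNMOVED; one finite 𝕋⁴ programme at fixed ε — NOTHING about the continuum, ℝ⁴, infinite volume, OS, a mass gap or Clay.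
References (TYPES only): [I] = Bałaban, CMP 109 (1987) (0.25)–(0.26) p. 257 (d_j(X), M-cubes, «M much bigger than the previously fixed scales»), (1.20)–(1.22) p. 264,
(5.10) p. 293 («δ₁ = ½ min{δ₀, κM⁻¹}»); [II] = CMP 116 (1988) (1.26) p. 8, (2.13)–(2.14) pp. 14–15, (2.40)–(2.41) p. 21.
-/

noncomputable section

open Finset
open scoped BigOperators

namespace YMDAG.N22.KernelFading

open Literature.MathematicalPhysics.QuantumFieldTheory.Balaban1983to89
open Literature.MathematicalPhysics.QuantumFieldTheory.Balaban1983to89.Node00 (U3Letters₁₁ Stage13Params U3Objects₁₁)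
open Literature.MathematicalPhysics.QuantumFieldTheory.Balaban1983to89.B12TreeDecay (kappa₀ a₀)
open Literature.MathematicalPhysics.QuantumFieldTheory.Balaban1983to89.B12Decay510 (delta1 delta1_le_half delta1_mul_le delta1_pos)
open Literature.MathematicalPhysics.QuantumFieldTheory.Balaban1983to89.B13Lemma3TorusNonvacuity (consts consts_L)
open Literature.MathematicalPhysics.QuantumFieldTheory.Balaban1983to89.B12Decay510Window (K₁ K₁_nonneg)
open Literature.MathematicalPhysics.QuantumFieldTheory.Balaban1983to89.Beta.RemainderConstNumerals (K₁_le_pow)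
open Literature.MathematicalPhysics.QuantumFieldTheory.Balaban1983to89.T4Continuum (T4Family)
open Literature.MathematicalPhysics.QuantumFieldTheory.Balaban1983to89.T4RecentScale (Multiplicity)
open Literature.MathematicalPhysics.QuantumFieldTheory.Balaban1983to89.Node00.U3OfKernels (carriers objectsOfRecord₁₃)
open YMDAG.UVSplit (u3OfRecord₁₃)

/-! ## §0 The two floors compared -/

/-- `0 < κ₀(64, 8)` in the rows' spelling `kappa₀ (4·2⁴) (2·4)` (it exceeds 325, J92). [folklore] -/
theorem kappa₀_four_pos : 0 < kappa₀ (4 * 2 ^ 4) (2 * 4) := by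
  rw [kappa₀_four_eq]; exact lt_trans (by norm_num) kappa₀_64_8_gt

/-- **THE r3 FLOOR IMPLIES THE r2 BLOCK FLOOR** for every block count `M ≥ 1`: `κ₀ ≤ x → κ₀ ≤ M·x`.  Hence everything certified ON today's floor (J93's joint witness)
holds on the block floor a fortiori. [cite: Balaban1987RG1, p.257 (M-cubes; bookkeeping on hypothesis letters)] -/
theorem blockFloor_of_floor (M : ℕ) [NeZero M] {x : ℝ} (h : kappa₀ (4 * 2 ^ 4) (2 * 4) ≤ x) :
    kappa₀ (4 * 2 ^ 4) (2 * 4) ≤ (M : ℝ) * x := by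
  have hM : (1 : ℝ) ≤ (M : ℝ) := by exact_mod_cast Nat.pos_of_ne_zero (NeZero.ne M)
  have hx : 0 ≤ x := kappa₀_four_pos.le.trans h
  calc kappa₀ (4 * 2 ^ 4) (2 * 4) ≤ x := h
    _ = 1 * x := (one_mul x).symm
    _ ≤ (M : ℝ) * x := mul_le_mul_of_nonneg_right hM hx

/-- **AT J89's CAP VALUE THE BLOCK FLOOR IS A THRESHOLD ON THE ACTIVITY LETTER ALONE.**  With `ℓ.κ` at the cap of `hℓκ`, `delta1 δ₀ κ (4M) = ½ min{δ₀, κ(4M)⁻¹}`, and the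
minimiser rate not binding (`κ(4M)⁻¹ ≤ δ₀`), `M · delta1 δ₀ κ (4M) = κ/8`, so the block floor `κ₀ ≤ M · delta1 δ₀ κ (4M)` READS `8κ₀ ≤ κ` — no M (J89 itself displays
`κ₀ ≤ κ/2`; the factor 4 is the `4M` of its `delta1` argument). [cite: Balaban1987RG1, (5.10) p.293 (δ₁ = ½ min{δ₀, κM⁻¹}; bookkeeping on hypothesis letters)] -/
theorem blockFloor_at_delta1_iff (M : ℕ) [NeZero M] {δ₀ κ : ℝ} (hδ : κ / ((M : ℝ) * 4) ≤ δ₀) :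
    kappa₀ (4 * 2 ^ 4) (2 * 4) ≤ (M : ℝ) * delta1 δ₀ κ ((M : ℝ) * 4) ↔ 8 * kappa₀ 64 8 ≤ κ := by
  rw [kappa₀_four_eq]
  have hM : (0 : ℝ) < (M : ℝ) := by exact_mod_cast Nat.pos_of_ne_zero (NeZero.ne M)
  have e : (M : ℝ) * delta1 δ₀ κ ((M : ℝ) * 4) = κ / 8 := by
    unfold delta1; rw [min_eq_right hδ]; field_simp; ring
  rw [e]
  constructor <;> intro h <;> linarith

/-! ## §1 ★ What the block floor on the kernel slot forces on J89's other letters -/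

/-- ★ **THE PROPAGATION LIST UNDER r2, N22 END.**  On the row types VERBATIM as displayed by J89 — `hκE : κ ≤ κE`, `hκr : κE ≤ r₁`, `hκ₅ : delta1 δ₀ κ ((M : ℝ) * 4) ≤ κ₅`,
`hℓκ : ℓ.κ ≤ delta1 δ₀ κ ((M : ℝ) * 4)` — the block floor `kappa₀ (4 * 2 ^ 4) (2 * 4) ≤ (M : ℝ) * ℓ.κ` forces: `2κ₀ ≤ M·δ₀` (M·δ₁ ≤ M·δ₀/2), **`8κ₀ ≤ κ ≤ κE ≤ r₁` with no
M** (δ₁·4M ≤ κ/2), `κ₀ ≤ M·κ₅`, and the fading-memory factor of `hC₉` is at least `exp (12κ₀)`.  Compare J92 §1 (r3 floor): `2κ₀ ≤ δ₀`, `8Mκ₀ ≤ κ`, `κ₀ ≤ κ₅`, `≥ exp (12Mκ₀)`.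
Letters only; nothing asserted about any object. [cite: Balaban1987RG1, (5.10) p.293 (δ₁ = ½ min{δ₀, κM⁻¹}) and (0.25) p.257 (M-cubes; bookkeeping on hypothesis letters)] -/
theorem locatedSize_of_kernelSlotBlockFloor (ℓ : U3Letters₁₁) (M : ℕ) [NeZero M] {κ κE r₁ δ₀ κ₅ : ℝ}
    (hκE : κ ≤ κE) (hκr : κE ≤ r₁) (hκ₅ : delta1 δ₀ κ ((M : ℝ) * 4) ≤ κ₅) (hℓκ : ℓ.κ ≤ delta1 δ₀ κ ((M : ℝ) * 4))
    (hbfloor : kappa₀ (4 * 2 ^ 4) (2 * 4) ≤ (M : ℝ) * ℓ.κ) :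
    2 * kappa₀ 64 8 ≤ (M : ℝ) * δ₀ ∧ 8 * kappa₀ 64 8 ≤ κ ∧ 8 * kappa₀ 64 8 ≤ κE ∧ 8 * kappa₀ 64 8 ≤ r₁ ∧ kappa₀ 64 8 ≤ (M : ℝ) * κ₅ ∧
      Real.exp (12 * kappa₀ 64 8) ≤ Real.exp (delta1 δ₀ κ ((M : ℝ) * 4) * ((M : ℝ) * 4) * 3) := by
  rw [kappa₀_four_eq] at hbfloor
  have hM : (0 : ℝ) < (M : ℝ) := by exact_mod_cast Nat.pos_of_ne_zero (NeZero.ne M)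
  have hM4 : (0 : ℝ) < (M : ℝ) * 4 := by positivity
  have h1 : kappa₀ 64 8 ≤ (M : ℝ) * delta1 δ₀ κ ((M : ℝ) * 4) := hbfloor.trans (mul_le_mul_of_nonneg_left hℓκ hM.le)
  have hδ₀ : 2 * kappa₀ 64 8 ≤ (M : ℝ) * δ₀ := by
    have h2 : (M : ℝ) * delta1 δ₀ κ ((M : ℝ) * 4) ≤ (M : ℝ) * (δ₀ / 2) := mul_le_mul_of_nonneg_left (delta1_le_half δ₀ κ ((M : ℝ) * 4)) hM.le
    linarith
  have hκ : 8 * kappa₀ 64 8 ≤ κ := by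
    have h2 : delta1 δ₀ κ ((M : ℝ) * 4) * ((M : ℝ) * 4) ≤ κ / 2 := delta1_mul_le δ₀ κ hM4
    have e : delta1 δ₀ κ ((M : ℝ) * 4) * ((M : ℝ) * 4) = 4 * ((M : ℝ) * delta1 δ₀ κ ((M : ℝ) * 4)) := by ring
    linarith
  have h₅ : kappa₀ 64 8 ≤ (M : ℝ) * κ₅ := h1.trans (mul_le_mul_of_nonneg_left hκ₅ hM.le)
  refine ⟨hδ₀, hκ, hκ.trans hκE, hκ.trans (hκE.trans hκr), h₅, Real.exp_le_exp.2 ?_⟩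
  have e : delta1 δ₀ κ ((M : ℝ) * 4) * ((M : ℝ) * 4) * 3 = 12 * ((M : ℝ) * delta1 δ₀ κ ((M : ℝ) * 4)) := by ring
  rw [e]; linarith

/-- ★ **NUMERIC FACES UNDER r2** (`κ₀ > 325`): the block floor forces `650 < M·δ₀`, `2600 < κ`, `2600 < r₁`, `325 < M·κ₅` and an `hC₉` factor `> exp 3900` — every bound
M-FREE or relaxed BY M (r3, J92 §1: `650 < δ₀`, `2600·M < κ`, `2600·M < r₁`, `325 < κ₅`, `> exp (3900·M)`).  Letters only.
[cite: Balaban1987RG1, (5.10) p.293 and p.257 (bookkeeping on hypothesis letters)] -/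
theorem locatedSize_blockFloor_numerals (ℓ : U3Letters₁₁) (M : ℕ) [NeZero M] {κ κE r₁ δ₀ κ₅ : ℝ}
    (hκE : κ ≤ κE) (hκr : κE ≤ r₁) (hκ₅ : delta1 δ₀ κ ((M : ℝ) * 4) ≤ κ₅) (hℓκ : ℓ.κ ≤ delta1 δ₀ κ ((M : ℝ) * 4))
    (hbfloor : kappa₀ (4 * 2 ^ 4) (2 * 4) ≤ (M : ℝ) * ℓ.κ) :
    650 < (M : ℝ) * δ₀ ∧ 2600 < κ ∧ 2600 < r₁ ∧ 325 < (M : ℝ) * κ₅ ∧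
      Real.exp 3900 < Real.exp (delta1 δ₀ κ ((M : ℝ) * 4) * ((M : ℝ) * 4) * 3) := by
  obtain ⟨hδ₀, hκ, -, hr₁, h₅, hC₉⟩ := locatedSize_of_kernelSlotBlockFloor ℓ M hκE hκr hκ₅ hℓκ hbfloor
  have hκ₀ := kappa₀_64_8_gt
  refine ⟨by linarith, by linarith, by linarith, by linarith, lt_of_lt_of_le (Real.exp_lt_exp.2 (by linarith)) hC₉⟩

/-! ## §2 At the certified constants record `consts`: under r2 nothing is sized -/

/-- **A BLOCK-FLOOR-SIZED HISTORY RATE MEETS `hrate` AT `consts`, FOR EVERY BLOCK COUNT** (the condition is M-free): `r₁ := 8κ₀` gives `10κ₀ + 2 ≤ 32κ₀ + 2048`.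
Compare J92 §2 (r3 floor, `r₁ ≥ 8Mκ₀`): `M ≤ 4`. [cite: Balaban1987RG1, p.257 (M-cubes, «M much bigger than the previously fixed scales»; bookkeeping)] -/
theorem blockFloorSized_meets_hrate_consts :
    ∃ r₁ : ℝ, 8 * kappa₀ 64 8 ≤ r₁ ∧ r₁ + 2 * (64 * Real.log 162) + 2 ≤ (1 - 8 * consts.δ) * ((consts.L : ℝ) / 2) * consts.κ := by
  refine ⟨8 * kappa₀ 64 8, le_rfl, ?_⟩
  have e : kappa₀ 64 8 = 64 * Real.log 162 := by unfold kappa₀ a₀; norm_num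
  rw [hrate_rhs_consts, ← e]
  have := kappa₀_64_8_gt
  linarith

/-- **A BLOCK-FLOOR-SIZED HISTORY RATE LIES IN MODULE J90's CERTIFICATE RANGE `[2κ₀ + 1, consts.κ − 1]`, FOR EVERY BLOCK COUNT** (`consts.κ − 1 = 20κ₀ + 1279 ≥ 8κ₀`).
Compare J92 §2 (r3 floor): iff `M ≤ 2`. [cite: Balaban1988RG2Cluster, p.21 (closing paragraph; bookkeeping at the witness)] -/
theorem blockFloorSized_in_certificateRange :
    ∃ r₁ : ℝ, 2 * kappa₀ (4 * 2 ^ 4) (2 * 4) + 1 ≤ r₁ ∧ r₁ ≤ consts.κ - 1 ∧ 8 * kappa₀ 64 8 ≤ r₁ := by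
  rw [kappa₀_four_eq, consts_κ_eq]
  have := kappa₀_64_8_gt
  exact ⟨8 * kappa₀ 64 8, by linarith, by linarith, le_rfl⟩

/-- ★ **UNDER r2 EVERY BLOCK COUNT IS AVAILABLE ON THIS LANE's SOCKET.**  For every `M ≥ 1` the five rate rows of J89 (`hℓκ hκ₅ hκE hκr` and its own activity threshold
`hκ₀ : κ₀ ≤ κ/2`), the block floor `κ₀ ≤ M·ℓ.κ` and `hrate` at `consts` are JOINTLY met by the letters `ℓ.κ := κ₀/M`, `δ₀ := 2κ₀/M`, `κ = κE = r₁ := 8κ₀`, `κ₅ := κ₀/M` — at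
which `delta1 δ₀ κ (4M) = κ₀/M = ℓ.κ` exactly: the kernel letter tends to 0 as M grows, as (5.10)'s `δ₁ = ½ min{δ₀, κM⁻¹}` does, while the activity letters stay put.  (The other
rows of J89 — owner rows, reading atoms, chart block — are not re-certified here; J93 witnessed the 45 non-owner binders jointly ON the r3 floor, hence on the block floor by
`blockFloor_of_floor`.)  Letters only. [cite: Balaban1987RG1, (5.10) p.293 and p.257 («M much bigger than the previously fixed scales»; bookkeeping on hypothesis letters)] -/
theorem blockFloor_jointRateRows_witness_every_blockCount (M : ℕ) [NeZero M] :
    ∃ (ℓ : U3Letters₁₁) (δ₀ κ κE r₁ κ₅ : ℝ),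
      kappa₀ (4 * 2 ^ 4) (2 * 4) ≤ (M : ℝ) * ℓ.κ ∧ ℓ.κ ≤ delta1 δ₀ κ ((M : ℝ) * 4) ∧ delta1 δ₀ κ ((M : ℝ) * 4) ≤ κ₅ ∧ κ ≤ κE ∧ κE ≤ r₁ ∧
      kappa₀ (4 * 2 ^ 4) (2 * 4) ≤ κ / 2 ∧ r₁ + 2 * (64 * Real.log 162) + 2 ≤ (1 - 8 * consts.δ) * ((consts.L : ℝ) / 2) * consts.κ ∧
      ℓ.κ = kappa₀ 64 8 / M ∧ delta1 δ₀ κ ((M : ℝ) * 4) = kappa₀ 64 8 / M ∧ 0 < ℓ.κ ∧ 0 < δ₀ := by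
  have hM : (0 : ℝ) < (M : ℝ) := by exact_mod_cast Nat.pos_of_ne_zero (NeZero.ne M)
  have hκ₀ := kappa₀_64_8_gt
  have hκ₀pos : 0 < kappa₀ 64 8 := lt_trans (by norm_num) hκ₀
  have hd : delta1 (2 * kappa₀ 64 8 / M) (8 * kappa₀ 64 8) ((M : ℝ) * 4) = kappa₀ 64 8 / M := by
    have e : 8 * kappa₀ 64 8 / ((M : ℝ) * 4) = 2 * kappa₀ 64 8 / M := by field_simp; ring
    unfold delta1; rw [e, min_self]; ring
  refine ⟨⟨kappa₀ 64 8 / M, 0, 0, 0, 0, 0, 0⟩, 2 * kappa₀ 64 8 / M, 8 * kappa₀ 64 8, 8 * kappa₀ 64 8, 8 * kappa₀ 64 8, kappa₀ 64 8 / M,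
    ?_, ?_, ?_, le_rfl, le_rfl, ?_, ?_, rfl, hd, div_pos hκ₀pos hM, by positivity⟩
  · rw [kappa₀_four_eq]; show kappa₀ 64 8 ≤ (M : ℝ) * (kappa₀ 64 8 / M); rw [mul_div_cancel₀ _ hM.ne']
  · show kappa₀ 64 8 / M ≤ _; rw [hd]
  · rw [hd]
  · rw [kappa₀_four_eq]; linarith
  · have e : kappa₀ 64 8 = 64 * Real.log 162 := by unfold kappa₀ a₀; norm_num
    rw [hrate_rhs_consts, ← e]; linarith

/-! ## §3 At the kernel pin (J94): the census constant the block floor buys, uniformly in the kernel letter -/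

/-- **`K₁ 4 x ≤ (1 + 2M/κ₀)⁴` ON THE BLOCK FLOOR** (`K₁_le_pow`: `K₁ 4 x ≤ (1 + 2/x)⁴`, and `κ₀ ≤ M·x` gives `2/x ≤ 2M/κ₀`).  [folklore] -/
theorem K₁_le_on_blockFloor {x : ℝ} (hx : 0 < x) (M : ℕ) (hbfloor : kappa₀ (4 * 2 ^ 4) (2 * 4) ≤ (M : ℝ) * x) :
    K₁ 4 x ≤ (1 + 2 * (M : ℝ) / kappa₀ 64 8) ^ 4 := by
  rw [kappa₀_four_eq] at hbfloor
  have hκ₀ : 0 < kappa₀ 64 8 := lt_trans (by norm_num) kappa₀_64_8_gt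
  have h2 : 2 / x ≤ 2 * (M : ℝ) / kappa₀ 64 8 := by
    rw [div_le_div_iff₀ hx hκ₀]; nlinarith
  exact (K₁_le_pow hx 4).trans (pow_le_pow_left₀ (by positivity) (by linarith) 4)

/-- The kernel letter is POSITIVE on the block floor (`0 < κ₀ ≤ M·x`, `M ≥ 0`). [folklore] -/
theorem pos_of_blockFloor {x : ℝ} (M : ℕ) (hbfloor : kappa₀ (4 * 2 ^ 4) (2 * 4) ≤ (M : ℝ) * x) : 0 < x := by
  have hMx : 0 < (M : ℝ) * x := kappa₀_four_pos.trans_le hbfloor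
  have hM : (0 : ℝ) ≤ (M : ℝ) := Nat.cast_nonneg M
  by_contra h
  exact absurd (mul_nonpos_of_nonneg_of_nonpos hM (not_lt.1 h)) (not_le.2 hMx)

/-- **EVERY SCALE SLICE OF EVERY FINITE LEDGER ON THE KERNEL CARRIER HAS CENSUS `≤ 16·(1 + 2M/κ₀)⁴` ON THE BLOCK FLOOR** — J94 §2's `16·K₁ 4 κ` under §3's bound;
uniform in κ. [folklore] -/
theorem sliceSum_kernelCarriers_le_on_blockFloor (fac : Finset carriers.Dom) {κ : ℝ} (M : ℕ) (hbfloor : kappa₀ (4 * 2 ^ 4) (2 * 4) ≤ (M : ℝ) * κ) (j : ℕ) :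
    ∑ X ∈ fac with carriers.scale X = j, Real.exp (-(κ * carriers.d X)) ≤ 16 * (1 + 2 * (M : ℝ) / kappa₀ 64 8) ^ 4 :=
  have hκ := pos_of_blockFloor M hbfloor
  (sliceSum_kernelCarriers_le fac hκ j).trans (mul_le_mul_of_nonneg_left (K₁_le_on_blockFloor hκ M hbfloor) (by norm_num))

/-- ★★ **THE (0.26) CENSUS ON THE KERNEL CARRIER UNDER r2: CONSTANT `16·(1 + 2M/κ₀ 64 8)⁴`, UNIFORM IN THE KERNEL LETTER** [bookkeeping].  From the block floor
`κ₀ ≤ M·κ` alone (κ > 0 follows), for every finite ledger, cutoff `K`, `vol ≥ 1`, `Λ ≥ 1`: `Multiplicity fac carriers.scale (X ↦ e^{−κ·d X}) (16·(1 + 2M/κ₀)⁴) vol Λ K`.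
The constant is a polynomial of degree d = 4 in the block count — the `M^d` by which [I] p. 257 renormalises volumes when «cubes from π_j become unit cubes» — and NO
identification rows (m) are needed (J94).  Under the r3 floor the same constant is `< 17` (`kernelCensusConst_lt_seventeen_on_floor`). [cite: Balaban1987RG1, (0.26) p.257 (census in M-cubes; bookkeeping)] -/
theorem multiplicity_kernelCarriers_on_blockFloor {κ vol Λ : ℝ} (M : ℕ) (hbfloor : kappa₀ (4 * 2 ^ 4) (2 * 4) ≤ (M : ℝ) * κ)
    (hvol : 1 ≤ vol) (hΛ : 1 ≤ Λ) (fac : Finset carriers.Dom) (K : ℕ) :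
    Multiplicity fac carriers.scale (fun X => Real.exp (-(κ * carriers.d X))) (16 * (1 + 2 * (M : ℝ) / kappa₀ 64 8) ^ 4) vol Λ K := by
  have hκ := pos_of_blockFloor M hbfloor
  intro j hj
  have hK : 16 * K₁ 4 κ ≤ 16 * (1 + 2 * (M : ℝ) / kappa₀ 64 8) ^ 4 := mul_le_mul_of_nonneg_left (K₁_le_on_blockFloor hκ M hbfloor) (by norm_num)
  refine (multiplicity_kernelCarriers hκ hvol hΛ fac K j hj).trans ?_
  exact mul_le_mul_of_nonneg_right (mul_le_mul_of_nonneg_right hK (zero_le_one.trans hvol)) (pow_nonneg (zero_le_one.trans hΛ) _)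

section Record

variable {N : ℕ} [NeZero N]

/-- ★★ **THE r2 CENSUS ANTECEDENT OF N19′'s LEDGER PREDICATE AT THE OBJECTS OF RECORD** [bookkeeping].  At `R.u3 := u3OfRecord₁₃ θ (objectsOfRecord₁₃ F N θ ℓ) k` the
carrier IS the kernel carrier and `R.u3.κ` IS `ℓ.κ` (`rfl`, J94 §3); so from the block floor `κ₀ ≤ M·ℓ.κ`, `vol ≥ 1`, `Λg ≥ 1`:
`∀ K, Multiplicity (All K) R.u3.C.scale (fun X => Real.exp (-(R.u3.κ * R.u3.C.d X))) (16·(1 + 2M/κ₀ 64 8)⁴) vol Λg K` — the shape of the `hL` antecedent, with the census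
constant r2 buys, uniform in `ℓ.κ`.  NOT an N19 edition; N22 NOT discharged. [cite: Balaban1987RG1, (0.26) p.257 (census in M-cubes; bookkeeping)] -/
theorem multiplicity_u3OfRecord₁₃_objectsOfRecord₁₃_on_blockFloor (F : T4Family) (θ : Stage13Params F N) (ℓ : U3Letters₁₁) (k : ℕ) (M : ℕ)
    (hbfloor : kappa₀ (4 * 2 ^ 4) (2 * 4) ≤ (M : ℝ) * ℓ.κ) {vol Λg : ℝ} (hvol : 1 ≤ vol) (hΛ : 1 ≤ Λg)
    (All : ℕ → Finset (u3OfRecord₁₃ θ (objectsOfRecord₁₃ F N θ ℓ) k).C.Dom) (K : ℕ) :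
    Multiplicity (All K) (u3OfRecord₁₃ θ (objectsOfRecord₁₃ F N θ ℓ) k).C.scale
      (fun X => Real.exp (-((u3OfRecord₁₃ θ (objectsOfRecord₁₃ F N θ ℓ) k).κ * (u3OfRecord₁₃ θ (objectsOfRecord₁₃ F N θ ℓ) k).C.d X)))
      (16 * (1 + 2 * (M : ℝ) / kappa₀ 64 8) ^ 4) vol Λg K :=
  multiplicity_kernelCarriers_on_blockFloor M hbfloor hvol hΛ (All K) K

/-- The same under a pin `u = objectsOfRecord₁₃ F N θ ℓ` (the shape of dag-n27-c's leaf pin). [cite: Balaban1987RG1, (0.26) p.257 (bookkeeping)] -/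
theorem multiplicity_u3OfRecord₁₃_of_pin_on_blockFloor (F : T4Family) (θ : Stage13Params F N) (ℓ : U3Letters₁₁) {u : U3Objects₁₁}
    (hu : u = objectsOfRecord₁₃ F N θ ℓ) (k : ℕ) (M : ℕ) (hbfloor : kappa₀ (4 * 2 ^ 4) (2 * 4) ≤ (M : ℝ) * ℓ.κ)
    {vol Λg : ℝ} (hvol : 1 ≤ vol) (hΛ : 1 ≤ Λg) (All : ℕ → Finset (u3OfRecord₁₃ θ u k).C.Dom) (K : ℕ) :
    Multiplicity (All K) (u3OfRecord₁₃ θ u k).C.scale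
      (fun X => Real.exp (-((u3OfRecord₁₃ θ u k).κ * (u3OfRecord₁₃ θ u k).C.d X))) (16 * (1 + 2 * (M : ℝ) / kappa₀ 64 8) ^ 4) vol Λg K := by
  subst hu
  exact multiplicity_u3OfRecord₁₃_objectsOfRecord₁₃_on_blockFloor F θ ℓ k M hbfloor hvol hΛ All K

end Record

/-! ## §4 Numerals of the two census constants -/

/-- **`16·(1 + 2M/κ₀)⁴ < 16·(1 + M/162)⁴`** for `M ≥ 1` (`κ₀ > 325 > 324 = 2·162`). [folklore] -/
theorem blockFloor_censusConst_lt (M : ℕ) [NeZero M] :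
    16 * (1 + 2 * (M : ℝ) / kappa₀ 64 8) ^ 4 < 16 * (1 + (M : ℝ) / 162) ^ 4 := by
  have hM : (0 : ℝ) < (M : ℝ) := by exact_mod_cast Nat.pos_of_ne_zero (NeZero.ne M)
  have hκ₀ := kappa₀_64_8_gt
  have hκ₀pos : 0 < kappa₀ 64 8 := lt_trans (by norm_num) hκ₀
  have h : 2 * (M : ℝ) / kappa₀ 64 8 < (M : ℝ) / 162 := by
    rw [div_lt_div_iff₀ hκ₀pos (by norm_num)]; nlinarith [mul_lt_mul_of_pos_left hκ₀ hM]
  have h0 : (0 : ℝ) ≤ 1 + 2 * (M : ℝ) / kappa₀ 64 8 := by positivity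
  exact mul_lt_mul_of_pos_left (pow_lt_pow_left₀ (by linarith) h0 (by norm_num)) (by norm_num)

/-- **ON THE r3 FLOOR THE KERNEL-CARRIER CENSUS CONSTANT IS `< 17`**: `κ₀ ≤ x` gives `16·K₁ 4 x ≤ 16(1 + 2/x)⁴ ≤ 16(1 + 2/325)⁴ < 17`. [folklore] -/
theorem kernelCensusConst_lt_seventeen_on_floor {x : ℝ} (hfloor : kappa₀ (4 * 2 ^ 4) (2 * 4) ≤ x) : 16 * K₁ 4 x < 17 := by
  rw [kappa₀_four_eq] at hfloor
  have hκ₀ := kappa₀_64_8_gt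
  have hx : 325 < x := hκ₀.trans_le hfloor
  have hxpos : 0 < x := lt_trans (by norm_num) hx
  have h1 : K₁ 4 x ≤ (1 + 2 / x) ^ 4 := K₁_le_pow hxpos 4
  have h2 : 2 / x ≤ 2 / 325 := div_le_div_of_nonneg_left (by norm_num) (by norm_num) hx.le
  have h3 : (1 + 2 / x) ^ 4 ≤ (1 + 2 / 325 : ℝ) ^ 4 := pow_le_pow_left₀ (by positivity) (by linarith) 4
  have h4 : (16 : ℝ) * (1 + 2 / 325) ^ 4 < 17 := by norm_num
  nlinarith [K₁_nonneg 4 x]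

end YMDAG.N22.KernelFading

end
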